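import Literature.GroupTheory.Coxeter.CoxeterNumberReflections
import Literature.GroupTheory.Coxeter.LongestElementCentral
import HarnessLib

/-!
# The number of reflections (= positive roots = `ℓ(w₀)`) of the exceptional finite Coxeter groups: `N(E_6) = 36`, `N(E_7) = 63`, `N(E_8) = 120`, `N(F_4) = 24`, `N(H_3) = 15`, `N(H_4) = 60` (Humphreys 1990 §3.18 Table 2), via `2N = nh`

Layer `Literature/GroupTheory/Coxeter`, namespace `Literature.GroupTheory.Coxeter`; lane `lit-hodgefound` (Track 2 foundations library; prover seat p18,
generation 56, eighth file — over `CoxeterNumberReflections` (★ §3.18 Proposition classification-free: `two_mul_natCard_isReflection_eq_card_mul_orderOf_wordProd`),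
`CoxeterNumberExceptionalTypes` (`h(E_6) = 12`, `h(E_7) = 18`, `h(E_8) = 30`, `h(F_4) = 12`, `h(H_3) = 10`, `h(H_4) = 30`: `orderOf_wordProd_typeX`),
`ExceptionalTypesPositiveDefinite` (`finite_of_type_X`), `LongestElementCentral` (`connected_coxeterGraph_exceptional`, `connected_coxeterGraph_F₄`),
`BipartiteCoxeterElements` (`exists_colouring_of_finite`), `LongestElement` (`natCard_isReflection_of_forall_isLeftDescent`) and `RootSystemFinite`
(`natCard_nonneg_roots_eq_natCard_isReflection`)).

Humphreys §3.18 p. 80, Table 2 («Number of positive roots and Coxeter number»): `N = 36, 63, 120, 24, 15, 60` and `h = 12, 18, 30, 12, 10, 30` for `E_6, E_7, E_8, F_4,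
H_3, H_4` («By comparing Table 2 in 2.11, one quickly finds all values of `h`»; here conversely `N = nh/2` from the Coxeter numbers computed in the tree).  The classical types
and `I_2(m)`, `G_2` are in `FiniteTypesOrders` ∕ `CoxeterNumberClassicalTypes` (models); for the six exceptional types the tree has no model, and the count below is the
first: it holds for EVERY Coxeter system of the given Coxeter matrix.

* §1 ★★ `2ℓ(w₀) = nh` for any Coxeter element, without the colouring bookkeeping (`two_mul_length_top_eq_card_mul_orderOf`), and the three counts packaged
  (`natCard_isReflection_eq_of_orderOf_eq`);
* §2 ★★ **`N(E_6) = 36`, `N(E_7) = 63`, `N(E_8) = 120`, `N(F_4) = 24`, `N(H_3) = 15`, `N(H_4) = 60`** (`natCard_isReflection_typeE₆`, …), the same numbers for `ℓ(w₀)`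
  (`length_top_typeE₈`, …) and for the number of positive roots of the geometric representation (`natCard_nonneg_roots_typeE₈`, …).

PROVED theorems only (no definition, no named fact, no `sorry`: net debt 0); no instance, no notation.

## Source, verbatim

J. E. Humphreys, *Reflection Groups and Coxeter Groups* (Cambridge 1990) [Humphreys1990] (held `book:humphreys1990-reflection-groups-coxeter-groups`, chunk p0079 read;
book §3.18 p. 80 Table 2): `A_n: n(n+1)/2, n+1`; `B_n: n², 2n`; `D_n: n(n−1), 2(n−1)`; `E_6: 36, 12`; `E_7: 63, 18`; `E_8: 120, 30`; `F_4: 24, 12`; `G_2: 6, 6`; `H_3: 15, 10`;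
`H_4: 60, 30`; `I_2(m): m, m`.
-/

namespace Literature.GroupTheory.Coxeter

/-! ### §1 `2ℓ(w₀) = nh` for any Coxeter element, colouring-free -/

section General

variable {B : Type*} [Fintype B] [DecidableEq B] {M : CoxeterMatrix B} {W : Type*} [Group W] (cs : CoxeterSystem M W)

/-- ★★ **`2ℓ(w₀) = n·h`** for any Coxeter element `π l` (the colouring of `two_mul_natCard_isReflection_eq_card_mul_orderOf_wordProd` chosen internally).
[cite: Humphreys1990, §3.18 Proposition p. 79, §1.8 p. 16] -/
theorem two_mul_length_top_eq_card_mul_orderOf [Finite W] [Nontrivial B] (hconn : (coxeterGraph M).Connected) {l : List B} (hl : l.Nodup) (hls : ∀ i, i ∈ l)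
    {w₀ : W} (hw₀ : ∀ i, cs.IsLeftDescent w₀ i) : 2 * cs.length w₀ = Fintype.card B * orderOf (cs.wordProd l) := by
  obtain ⟨f, hf⟩ := exists_colouring_of_finite cs
  have hly : ∀ i, i ∈ l.filter (fun i ↦ f i) ↔ f i = true := fun i ↦ by
    rw [List.mem_filter]; exact ⟨fun h ↦ h.2, fun h ↦ ⟨hls i, h⟩⟩
  have hlz : ∀ i, i ∈ l.filter (fun i ↦ !f i) ↔ f i = false := fun i ↦ by
    rw [List.mem_filter]
    constructor
    · intro h; cases hfi : f i <;> simp_all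
    · intro h; exact ⟨hls i, by simp [h]⟩
  rw [← natCard_isReflection_of_forall_isLeftDescent hw₀]
  exact two_mul_natCard_isReflection_eq_card_mul_orderOf_wordProd cs f hf hly hlz (hl.filter _) (hl.filter _) hconn hl hls

/-- The three counts from `2N = nh`: reflections, `ℓ(w₀)`, positive roots. [cite: Humphreys1990, §3.18 Proposition p. 79, §1.14 p. 24] -/
theorem natCard_isReflection_eq_of_orderOf_eq [Finite W] [Nontrivial B] (hconn : (coxeterGraph M).Connected) {l : List B} (hl : l.Nodup) (hls : ∀ i, i ∈ l)
    {h N : ℕ} (hh : orderOf (cs.wordProd l) = h) (hN : Fintype.card B * h = 2 * N) :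
    Nat.card {t // cs.IsReflection t} = N ∧ (∀ w₀ : W, (∀ i, cs.IsLeftDescent w₀ i) → cs.length w₀ = N) ∧
      Nat.card {β : B → ℝ // (∃ (u : W) (i : B), β = geomRep cs u (e i)) ∧ (0 : B → ℝ) ≤ β} = N := by
  obtain ⟨x, hx⟩ := exists_forall_isLeftDescent cs
  have h1 := two_mul_length_top_eq_card_mul_orderOf cs hconn hl hls hx
  rw [hh, hN, ← natCard_isReflection_of_forall_isLeftDescent hx] at h1
  have h2 : Nat.card {t // cs.IsReflection t} = N := by omega
  exact ⟨h2, fun w₀ hw₀ ↦ by rw [← natCard_isReflection_of_forall_isLeftDescent hw₀, h2], by rw [natCard_nonneg_roots_eq_natCard_isReflection, h2]⟩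

end General

/-! ### §2 Table 2 for the exceptional types -/

section Exceptional

variable {W : Type*} [Group W]

/-- ★★ **`E_6` has `N = 36` reflections** (`n = 6`, `h = 12`), for every Coxeter system of type `E_6`; also `ℓ(w₀) = 36` and `36` positive roots. [cite: Humphreys1990,
§3.18 Table 2 p. 80] -/
theorem natCard_isReflection_typeE₆ (cs : CoxeterSystem CoxeterMatrix.E₆ W) :
    Nat.card {t // cs.IsReflection t} = 36 ∧ (∀ w₀ : W, (∀ i, cs.IsLeftDescent w₀ i) → cs.length w₀ = 36) ∧
      Nat.card {β : Fin 6 → ℝ // (∃ (u : W) (i : Fin 6), β = geomRep cs u (e i)) ∧ (0 : Fin 6 → ℝ) ≤ β} = 36 := by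
  haveI := finite_of_type_E₆ cs
  exact natCard_isReflection_eq_of_orderOf_eq cs connected_coxeterGraph_exceptional.1 (List.nodup_finRange 6) (List.mem_finRange)
    (orderOf_wordProd_typeE₆ cs (List.nodup_finRange 6) (List.mem_finRange)) (by simp)

/-- ★★ **`E_7` has `N = 63` reflections** (`n = 7`, `h = 18`); `ℓ(w₀) = 63`, `63` positive roots. [cite: Humphreys1990, §3.18 Table 2 p. 80] -/
theorem natCard_isReflection_typeE₇ (cs : CoxeterSystem CoxeterMatrix.E₇ W) :
    Nat.card {t // cs.IsReflection t} = 63 ∧ (∀ w₀ : W, (∀ i, cs.IsLeftDescent w₀ i) → cs.length w₀ = 63) ∧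
      Nat.card {β : Fin 7 → ℝ // (∃ (u : W) (i : Fin 7), β = geomRep cs u (e i)) ∧ (0 : Fin 7 → ℝ) ≤ β} = 63 := by
  haveI := finite_of_type_E₇ cs
  exact natCard_isReflection_eq_of_orderOf_eq cs connected_coxeterGraph_exceptional.2.1 (List.nodup_finRange 7) (List.mem_finRange)
    (orderOf_wordProd_typeE₇ cs (List.nodup_finRange 7) (List.mem_finRange)) (by simp)

/-- ★★ **`E_8` has `N = 120` reflections** (`n = 8`, `h = 30`); `ℓ(w₀) = 120`, `120` positive roots. [cite: Humphreys1990, §3.18 Table 2 p. 80] -/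
theorem natCard_isReflection_typeE₈ (cs : CoxeterSystem CoxeterMatrix.E₈ W) :
    Nat.card {t // cs.IsReflection t} = 120 ∧ (∀ w₀ : W, (∀ i, cs.IsLeftDescent w₀ i) → cs.length w₀ = 120) ∧
      Nat.card {β : Fin 8 → ℝ // (∃ (u : W) (i : Fin 8), β = geomRep cs u (e i)) ∧ (0 : Fin 8 → ℝ) ≤ β} = 120 := by
  haveI := finite_of_type_E₈ cs
  exact natCard_isReflection_eq_of_orderOf_eq cs connected_coxeterGraph_exceptional.2.2.1 (List.nodup_finRange 8) (List.mem_finRange)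
    (orderOf_wordProd_typeE₈ cs (List.nodup_finRange 8) (List.mem_finRange)) (by simp)

/-- ★★ **`F_4` has `N = 24` reflections** (`n = 4`, `h = 12`); `ℓ(w₀) = 24`, `24` positive roots. [cite: Humphreys1990, §3.18 Table 2 p. 80] -/
theorem natCard_isReflection_typeF₄ (cs : CoxeterSystem CoxeterMatrix.F₄ W) :
    Nat.card {t // cs.IsReflection t} = 24 ∧ (∀ w₀ : W, (∀ i, cs.IsLeftDescent w₀ i) → cs.length w₀ = 24) ∧
      Nat.card {β : Fin 4 → ℝ // (∃ (u : W) (i : Fin 4), β = geomRep cs u (e i)) ∧ (0 : Fin 4 → ℝ) ≤ β} = 24 := by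
  haveI := finite_of_type_F₄ cs
  exact natCard_isReflection_eq_of_orderOf_eq cs connected_coxeterGraph_F₄ (List.nodup_finRange 4) (List.mem_finRange)
    (orderOf_wordProd_typeF₄ cs (List.nodup_finRange 4) (List.mem_finRange)) (by simp)

/-- ★★ **`H_3` has `N = 15` reflections** (`n = 3`, `h = 10`); `ℓ(w₀) = 15`, `15` positive roots («The group of type `H_3` has … `N = 15`»). [cite: Humphreys1990, §3.18
Table 2 and Example p. 80] -/
theorem natCard_isReflection_typeH₃ (cs : CoxeterSystem CoxeterMatrix.H₃ W) :
    Nat.card {t // cs.IsReflection t} = 15 ∧ (∀ w₀ : W, (∀ i, cs.IsLeftDescent w₀ i) → cs.length w₀ = 15) ∧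
      Nat.card {β : Fin 3 → ℝ // (∃ (u : W) (i : Fin 3), β = geomRep cs u (e i)) ∧ (0 : Fin 3 → ℝ) ≤ β} = 15 := by
  haveI := finite_of_type_H₃ cs
  exact natCard_isReflection_eq_of_orderOf_eq cs connected_coxeterGraph_exceptional.2.2.2.1 (List.nodup_finRange 3) (List.mem_finRange)
    (orderOf_wordProd_typeH₃ cs (List.nodup_finRange 3) (List.mem_finRange)) (by simp)

/-- ★★ **`H_4` has `N = 60` reflections** (`n = 4`, `h = 30`); `ℓ(w₀) = 60`, `60` positive roots («for which `N = 60`, `h = 30`»). [cite: Humphreys1990, §3.18 Table 2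
p. 80, §3.19 Example p. 81] -/
theorem natCard_isReflection_typeH₄ (cs : CoxeterSystem CoxeterMatrix.H₄ W) :
    Nat.card {t // cs.IsReflection t} = 60 ∧ (∀ w₀ : W, (∀ i, cs.IsLeftDescent w₀ i) → cs.length w₀ = 60) ∧
      Nat.card {β : Fin 4 → ℝ // (∃ (u : W) (i : Fin 4), β = geomRep cs u (e i)) ∧ (0 : Fin 4 → ℝ) ≤ β} = 60 := by
  haveI := finite_of_type_H₄ cs
  exact natCard_isReflection_eq_of_orderOf_eq cs connected_coxeterGraph_exceptional.2.2.2.2 (List.nodup_finRange 4) (List.mem_finRange)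
    (orderOf_wordProd_typeH₄ cs (List.nodup_finRange 4) (List.mem_finRange)) (by simp)

end Exceptional

end Literature.GroupTheory.Coxeter
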